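import Literature.Analysis.Complex.RademacherPhragmenLindelof
import Literature.NumberTheory.LFunctions.ZetaArgVariation
import Mathlib.NumberTheory.LSeries.Dirichlet
import HarnessLib

/-!
# Explicit convexity bound for `ζ` on `½ ≤ σ ≤ c` and the upper bound for `∫ log|ζ|`
# (Trudgian 2011, Lemmas 2.7–2.8, exact forms)

Trunk T-ANT (`NumberTheory/LFunctions`), family RH.  Second layer (after
`Literature/Analysis/Complex/RademacherPhragmenLindelof.lean`) of the analytic part of Turing's
method with Trudgian's constants — the bound `|∫_{t₁}^{t₂} S(t) dt| ≤ 2.067 + 0.059 log t₂`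
[Trudgian 2011, Thm 2.2] used by Platt–Trudgian (the named fact
`Literature.NumberTheory.LFunctions.abs_integral_zetaArgS_le_trudgian` of `TuringMethod.lean`).  By Turing's lemma
(`Literature.NumberTheory.LFunctions.pi_mul_integral_zetaArgS_eq`, `ZetaArgVariation.lean`) that bound is an upper bound for
`∫_{1/2}^∞ log|ζ(σ+it₂)| dσ` (this file) plus a lower bound for `∫_{1/2}^∞ log|ζ(σ+it₁)| dσ`
([Trudgian 2011, Lemmas 2.9–2.11], not here).  Everything below is PROVED:

* `Literature.NumberTheory.LFunctions.norm_riemannZeta_le_re_riemannZeta` — `|ζ(σ+it)| ≤ ζ(σ)` (`σ > 1`);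
  `Literature.NumberTheory.LFunctions.norm_riemannZeta₁_le_exp` — crude growth of the entire `ζ₁ = (s−1)ζ(s)` in `½ ≤ σ ≤ c`.
* `Literature.NumberTheory.LFunctions.norm_riemannZeta₁_le_convexity`, `Literature.NumberTheory.LFunctions.norm_riemannZeta_le_convexity` — **Lemma 2.7 in
  exact form**: if `|ζ(½+iu)| ≤ K|Q+½+iu|^θ` for all real `u` (`K > 0`, `θ ≥ 0`, `Q ≥ 0`) and
  `c > 1`, then for `½ ≤ σ ≤ c`, `s ≠ 1`,
  `|ζ(s)| ≤ K^{(c−σ)/(c−½)} ζ(c)^{(σ−½)/(c−½)} |Q+s|^{θ(c−σ)/(c−½)} · |Q+s|/|s−1|`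
  — Rademacher's theorem for `f = ζ₁`, `A = K, α = θ+1, B = ζ(c), β = 1`, which is the display
  `|(s−1)ζ(s)| ≤ [K^{c−σ} ζ(c)^{σ−½} |s|^{θ(c−σ)+c−½}]^{1/(c−½)}` in the proof of Lemma 2.7
  (there `Q = 0`).
* `Literature.NumberTheory.LFunctions.intervalIntegral_log_norm_riemannZeta_le`, `Literature.NumberTheory.LFunctions.setIntegral_Ioi_half_log_norm_riemannZeta_le`
  — **Lemma 2.8 in exact form**: for `t > 0` not an ordinate of a zero and `M = |Q+c+it|`,
  `∫_{1/2}^∞ log|ζ(σ+it)| dσ ≤ ∫_c^∞ log ζ(σ) dσ + ½(c−½) log(Kζ(c)) + (θ(c−½)/2) log M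
   + (c−½) log(M/t)`;
  with `Literature.NumberTheory.LFunctions.setIntegral_Ioi_log_norm_riemannZeta_le` (`∫_c^∞ log|ζ(σ+it)| ≤ ∫_c^∞ log ζ(σ)`,
  Trudgian's `m(c)`) and `Literature.NumberTheory.LFunctions.integrableOn_log_norm_riemannZeta_ofReal` (`log ζ(σ)` is integrable
  on `(c, ∞)`); `setIntegral_Ioi_half_log_norm_riemannZeta_le'` — the same as `a₁ + b₁ log t` for
  `t > t₀ ≥ 1` with `b₁ = θ(c−½)/2`, `a₁ = ∫_c^∞ log ζ + ½(c−½)log(Kζ(c)) + (b₁ + c − ½)(Q+c)²/(2t₀²)`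
  (Trudgian's `δ` made explicit).
* `Literature.abs_integral_zetaArgS_le_of_bounds(_of_not_ordinate)` — **assembly of Theorem 2.12**: if
  `U(t) = ∫_{1/2}^∞ log|ζ(σ+it)| dσ ≤ a₁ + b₁ log t` and `−U(t) ≤ a₂ + b₂ log t` for non-ordinates
  `t > t₀ ≥ 1`, then `|∫_{t₁}^{t₂} S(t) dt| ≤ (a₁+a₂)/π + ((b₁+b₂)/π) log t₂` for **all**
  `t₀ < t₁ ≤ t₂` (Turing's lemma `Literature.NumberTheory.LFunctions.pi_mul_integral_zetaArgS_eq` + density of non-ordinates).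
  With this file's `a₁, b₁` and the lower bound of [Trudgian 2011, Lemma 2.11] (`a₂`,
  `b₂ = (d²/2)(log 4 − 1)`; not yet in the tree) this is Theorem 2.12 as printed:
  `πa = …`, `2πb = θ(c−½) + d²(log 4 − 1)`.

## Faithfulness notes (read before citing Lemma 2.7 verbatim)

1. Trudgian words Lemma 2.7 with the hypothesis `|ζ(½+it)| ≤ Kt^θ` *for `t > t₀`*, but the
   Phragmén–Lindelöf step needs it on the whole line `σ = ½` (his footnote 3: Lemma 2.5 "in fact
   holds for all `t > 1`" by a computation).  We therefore assume the all-`u` bound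
   `|ζ(½+iu)| ≤ K|Q+½+iu|^θ` (any `Q ≥ 0`; on `σ = ½`, `|s−1| = |s| ≤ |Q+s|`).
2. Trudgian then replaces `|s|/|s−1|` and `|s|/t` by `1+δ`, `δ = 2·10⁻⁶`, "for `t > 168π`"; these
   two roundings actually need `t ≥ √((2σ−1)/(2δ+δ²)) ≈ 548` resp. `t ≥ σ/√(2δ+δ²) ≈ 550` at
   `σ = c = 1.1` (`> 168π ≈ 527.8`), so the lemma *as printed* fails by a factor `< 1 + 10⁻⁶` in a
   short range of `t`.  This is numerically immaterial for Theorem 2.2 (whose constants are rounded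
   up from `2.0666`, `0.0585`) but we keep the exact factors `|Q+s|/|s−1|`, `M/t` instead.

## References

* T. S. Trudgian, *Improvements to Turing's method*, Math. Comp. 80 (2011), 2259–2279, §2.2,
  Lemmas 2.5–2.8.  [Trudgian2011]
* H. Rademacher, *On the Phragmén–Lindelöf theorem and some applications*, Math. Z. 72 (1959),
  Thm 2.  [Rademacher1959]
* E. C. Titchmarsh, *The Theory of the Riemann Zeta-Function*, 2nd ed., §5.1 (convexity), §9.9.
-/

noncomputable section

/-!
# Explicit convexity bound for `ζ(s)` on `½ ≤ σ ≤ c` (Trudgian 2011, Lemma 2.7, exact form)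
-/

open Complex Real Set

namespace Literature.NumberTheory.LFunctions

/-- `‖ζ(s)‖ ≤ ζ(σ)` for `σ = Re s > 1` (termwise: `|n^{-s}| = n^{-σ}`). [folklore] -/
theorem norm_riemannZeta_le_re_riemannZeta {s : ℂ} (hs : 1 < s.re) :
    ‖riemannZeta s‖ ≤ (riemannZeta (s.re : ℂ)).re := by
  set σ : ℝ := s.re with hσdef
  have hsum1 : LSeriesSummable 1 (σ : ℂ) := LSeriesSummable_one_iff.2 (by simp [hs])
  have hterm : ∀ n, ‖LSeries.term 1 s n‖ = ‖LSeries.term 1 (σ : ℂ) n‖ := by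
    intro n
    rcases eq_or_ne n 0 with rfl | hn
    · simp
    rw [LSeries.norm_term_eq, LSeries.norm_term_eq, if_neg hn, if_neg hn]
    simp [hσdef]
  have hsum : Summable fun n ↦ ‖LSeries.term 1 s n‖ := by
    simp_rw [hterm]; exact hsum1.norm
  have h2 : ∀ n, ‖LSeries.term 1 (σ : ℂ) n‖ = (LSeries.term 1 (σ : ℂ) n).re := by
    intro n
    rcases eq_or_ne n 0 with rfl | hn
    · simp
    rw [LSeries.norm_term_eq, if_neg hn, LSeries.term_of_ne_zero hn]
    simp only [Pi.one_apply, norm_one, Complex.ofReal_re]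
    have : (n : ℂ) ^ (σ : ℂ) = ((n : ℝ) ^ σ : ℝ) := by
      rw [Complex.ofReal_cpow (Nat.cast_nonneg n)]; simp
    rw [this, show (1 : ℂ) = ((1 : ℝ) : ℂ) from rfl, ← Complex.ofReal_div, Complex.ofReal_re]
  have h3 : (LSeries 1 (σ : ℂ)).re = ∑' n, (LSeries.term 1 (σ : ℂ) n).re := by
    rw [LSeries, Complex.re_tsum hsum1]
  rw [← LSeries_one_eq_riemannZeta hs, ← LSeries_one_eq_riemannZeta (s := (σ : ℂ)) (by simp [hs])]
  calc ‖LSeries 1 s‖ ≤ ∑' n, ‖LSeries.term 1 s n‖ := norm_tsum_le_tsum_norm hsum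
    _ = ∑' n, ‖LSeries.term 1 (σ : ℂ) n‖ := tsum_congr hterm
    _ = ∑' n, (LSeries.term 1 (σ : ℂ) n).re := tsum_congr h2
    _ = (LSeries 1 (σ : ℂ)).re := h3.symm

/-- Growth of the entire function `ζ₁(s) = (s−1)ζ(s)` in a right half-strip: for `½ ≤ Re z ≤ c`,
`‖ζ₁(z)‖ ≤ 3 e^{2c+2} e^{2|Im z|}` (from the tree's `‖ζ₁(z)‖ ≤ ‖z‖ + ‖z‖‖z−1‖/Re z`,
`ZetaFractionalPartIntegral.lean`). [folklore] -/
theorem norm_riemannZeta₁_le_exp {c : ℝ} (hc : 1 < c) {z : ℂ} (h1 : 1 / 2 ≤ z.re) (h2 : z.re ≤ c) :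
    ‖riemannZeta₁ z‖ ≤ 3 * Real.exp (2 * c + 2) * Real.exp (2 * |z.im|) := by
  have hre : 0 < z.re := by linarith
  have h := Literature.NumberTheory.LFunctions.norm_riemannZeta₁_le_of_re_pos hre
  have hz : ‖z‖ ≤ c + |z.im| := by
    have := norm_le_abs_re_add_abs_im z
    rw [abs_of_pos hre] at this; linarith
  have hz1 : ‖z - 1‖ ≤ c + |z.im| := by
    refine (norm_le_abs_re_add_abs_im _).trans ?_
    simp only [sub_re, one_re, sub_im, one_im, sub_zero]
    have : |z.re - 1| ≤ c := by rw [abs_le]; constructor <;> linarith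
    linarith
  have hinv : ‖z‖ * ‖z - 1‖ / z.re ≤ 2 * (‖z‖ * ‖z - 1‖) := by
    rw [div_le_iff₀ hre]
    have hP : 0 ≤ ‖z‖ * ‖z - 1‖ := by positivity
    nlinarith [mul_nonneg hP (by linarith : (0:ℝ) ≤ 2 * z.re - 1)]
  set u := |z.im| with hu
  have hu0 : 0 ≤ u := abs_nonneg _
  have step1 : ‖riemannZeta₁ z‖ ≤ 3 * (c + u + 1) ^ 2 := by
    calc ‖riemannZeta₁ z‖ ≤ ‖z‖ + ‖z‖ * ‖z - 1‖ / z.re := h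
      _ ≤ (c + u) + 2 * ((c + u) * (c + u)) := by
          have := mul_le_mul hz hz1 (norm_nonneg _) (by linarith)
          linarith
      _ ≤ 3 * (c + u + 1) ^ 2 := by nlinarith
  have step2 : (c + u + 1) ^ 2 ≤ Real.exp (2 * c + 2) * Real.exp (2 * u) := by
    have hx : c + u + 1 ≤ Real.exp (c + u + 1) := by linarith [Real.add_one_le_exp (c + u + 1)]
    calc (c + u + 1) ^ 2 ≤ (Real.exp (c + u + 1)) ^ 2 := by gcongr
      _ = Real.exp (2 * c + 2) * Real.exp (2 * u) := by
          rw [sq, ← Real.exp_add, ← Real.exp_add]; ring_nf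
  calc ‖riemannZeta₁ z‖ ≤ 3 * (c + u + 1) ^ 2 := step1
    _ ≤ 3 * (Real.exp (2 * c + 2) * Real.exp (2 * u)) := by gcongr
    _ = 3 * Real.exp (2 * c + 2) * Real.exp (2 * u) := by ring

/-- **Trudgian 2011, Lemma 2.7 (exact form, for the entire `ζ₁ = (s−1)ζ(s)`).**  Suppose
`|ζ(½+it)| ≤ K |Q + ½ + it|^θ` for *all* real `t` (`K > 0`, `θ ≥ 0`, `Q ≥ 0`), and let `c > 1`.
Then for `½ ≤ σ ≤ c`,
`|(s−1)ζ(s)| ≤ K^{(c−σ)/(c−½)} ζ(c)^{(σ−½)/(c−½)} |Q+s|^{θ(c−σ)/(c−½) + 1}`.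
This is Rademacher's theorem (`Literature.Analysis.Complex.Rademacher.norm_le_exp_mul_rpow`) for `f = ζ₁`, `a = ½`, `b = c`,
`A = K`, `α = θ + 1` (on `σ = ½`: `|s−1| = |s| ≤ |Q+s|`), `B = ζ(c)`, `β = 1` (on `σ = c`:
`|ζ(s)| ≤ ζ(c)`, `|s−1| ≤ |Q+s|`) — exactly the display (2.?) "`|(s−1)ζ(s)| ≤ [K^{c−σ} ζ(c)^{σ−½}
|s|^{θ(c−σ)+c−½}]^{1/(c−½)}`" of [cite: Trudgian2011, proof of Lemma 2.7] (there with `Q = 0`).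
The hypothesis is needed on the whole line `σ = ½`, not only for `t > t₀` as Lemma 2.7 is worded
(cf. footnote 3 of the paper: Lemma 2.5 "holds for all `t > 1`" by a computation). -/
theorem norm_riemannZeta₁_le_convexity {K θ Q c : ℝ} (hK : 0 < K) (hθ : 0 ≤ θ) (hQ : 0 ≤ Q)
    (hc : 1 < c)
    (hline : ∀ t : ℝ, ‖riemannZeta (1 / 2 + t * I)‖ ≤ K * ‖(Q : ℂ) + (1 / 2 + t * I)‖ ^ θ)
    {s : ℂ} (h1 : 1 / 2 ≤ s.re) (h2 : s.re ≤ c) :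
    ‖riemannZeta₁ s‖ ≤ K ^ ((c - s.re) / (c - 1 / 2)) *
      (riemannZeta (c : ℂ)).re ^ ((s.re - 1 / 2) / (c - 1 / 2)) *
      ‖(Q : ℂ) + s‖ ^ (θ * ((c - s.re) / (c - 1 / 2)) + 1) := by
  have hab : (1 / 2 : ℝ) < c := by linarith
  have hB : 0 < (riemannZeta (c : ℂ)).re := riemannZeta_re_pos_of_one_lt hc
  -- growth
  set c₀ : ℝ := π / (c - 1 / 2) / 2 with hc₀
  have hc₀0 : 0 < c₀ := by have : (0:ℝ) < c - 1 / 2 := by linarith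
                           positivity
  have hc₀lt : c₀ < π / (c - 1 / 2) := by
    have : 0 < π / (c - 1 / 2) := div_pos Real.pi_pos (by linarith); rw [hc₀]; linarith
  have hgr : ∃ c' < π / (c - 1 / 2), ∃ K' L : ℝ, ∀ z : ℂ, 1 / 2 < z.re → z.re < c →
      ‖riemannZeta₁ z‖ ≤ K' * Real.exp (L * Real.exp (c' * |z.im|)) := by
    refine ⟨c₀, hc₀lt, 3 * Real.exp (2 * c + 2), 2 / c₀, fun z hz1 hz2 ↦ ?_⟩
    refine (norm_riemannZeta₁_le_exp hc hz1.le hz2.le).trans ?_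
    refine mul_le_mul_of_nonneg_left (Real.exp_le_exp.2 ?_) (by positivity)
    have := Real.add_one_le_exp (c₀ * |z.im|)
    calc 2 * |z.im| = 2 / c₀ * (c₀ * |z.im|) := by field_simp
      _ ≤ 2 / c₀ * Real.exp (c₀ * |z.im|) := by gcongr; linarith
  -- the edges
  have hQpos : ∀ z : ℂ, 1 / 2 ≤ z.re → 0 < ‖(Q : ℂ) + z‖ := by
    intro z hz
    refine lt_of_lt_of_le (by linarith : 0 < Q + z.re) (le_trans ?_ (abs_re_le_norm _))
    simp only [add_re, ofReal_re]; rw [abs_of_pos (by linarith)]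
  have ha : ∀ z : ℂ, z.re = 1 / 2 → ‖riemannZeta₁ z‖ ≤ K * ‖(Q : ℂ) + z‖ ^ (θ + 1) := by
    intro z hz
    have hz1 : z ≠ 1 := fun h ↦ by rw [h, Complex.one_re] at hz; norm_num at hz
    have e : z = 1 / 2 + z.im * I := by apply Complex.ext <;> simp [hz]
    have hζ : ‖riemannZeta z‖ ≤ K * ‖(Q : ℂ) + z‖ ^ θ := by
      have := hline z.im; rwa [← e] at this
    have hzm1 : ‖z - 1‖ ≤ ‖(Q : ℂ) + z‖ := by
      rw [e]
      have k1 : (1 / 2 : ℂ) + z.im * I - 1 = ((-(1 / 2) : ℝ) : ℂ) + z.im * I := by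
        push_cast; ring
      have k2 : (Q : ℂ) + (1 / 2 + z.im * I) = ((Q + 1 / 2 : ℝ) : ℂ) + z.im * I := by
        push_cast; ring
      rw [k1, k2, Complex.norm_add_mul_I, Complex.norm_add_mul_I]
      exact Real.sqrt_le_sqrt (by nlinarith)
    rw [LFunctions.riemannZeta₁_eq_mul hz1, norm_mul, Real.rpow_add (hQpos z hz.symm.le), Real.rpow_one]
    calc ‖z - 1‖ * ‖riemannZeta z‖ ≤ ‖(Q : ℂ) + z‖ * (K * ‖(Q : ℂ) + z‖ ^ θ) :=
          mul_le_mul hzm1 hζ (norm_nonneg _) (norm_nonneg _)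
      _ = K * (‖(Q : ℂ) + z‖ ^ θ * ‖(Q : ℂ) + z‖) := by ring
  have hb : ∀ z : ℂ, z.re = c → ‖riemannZeta₁ z‖ ≤ (riemannZeta (c : ℂ)).re * ‖(Q : ℂ) + z‖ ^ (1 : ℝ) := by
    intro z hz
    have hz1 : z ≠ 1 := fun h ↦ by rw [h, Complex.one_re] at hz; linarith
    have hζ : ‖riemannZeta z‖ ≤ (riemannZeta (c : ℂ)).re := by
      have := norm_riemannZeta_le_re_riemannZeta (s := z) (by rw [hz]; exact hc)
      rwa [hz] at this
    have hzm1 : ‖z - 1‖ ≤ ‖(Q : ℂ) + z‖ := by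
      have e : z = (c : ℂ) + z.im * I := by apply Complex.ext <;> simp [hz]
      rw [e]
      have k1 : (c : ℂ) + z.im * I - 1 = ((c - 1 : ℝ) : ℂ) + z.im * I := by push_cast; ring
      have k2 : (Q : ℂ) + ((c : ℂ) + z.im * I) = ((Q + c : ℝ) : ℂ) + z.im * I := by
        push_cast; ring
      rw [k1, k2, Complex.norm_add_mul_I, Complex.norm_add_mul_I]
      exact Real.sqrt_le_sqrt (by nlinarith)
    rw [LFunctions.riemannZeta₁_eq_mul hz1, norm_mul, Real.rpow_one]
    calc ‖z - 1‖ * ‖riemannZeta z‖ ≤ ‖(Q : ℂ) + z‖ * (riemannZeta (c : ℂ)).re :=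
          mul_le_mul hzm1 hζ (norm_nonneg _) (norm_nonneg _)
      _ = (riemannZeta (c : ℂ)).re * ‖(Q : ℂ) + z‖ := by ring
  have key := Literature.Analysis.Complex.Rademacher.norm_le_exp_mul_rpow (f := riemannZeta₁) hab (by linarith) hK hB
    (by linarith : (1 : ℝ) ≤ θ + 1) differentiable_riemannZeta₁.diffContOnCl hgr ha hb h1 h2
  rw [Real.exp_add, ← Real.rpow_def_of_pos hK, ← Real.rpow_def_of_pos hB] at key
  have hne : c - 1 / 2 ≠ 0 := by linarith
  have hexp : (θ + 1) * ((c - s.re) / (c - 1 / 2)) + 1 * ((s.re - 1 / 2) / (c - 1 / 2)) =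
      θ * ((c - s.re) / (c - 1 / 2)) + 1 := by
    rw [mul_div_assoc', mul_div_assoc', mul_div_assoc', ← add_div, div_add_one hne,
      div_left_inj' hne]
    ring
  rwa [hexp] at key

/-- **Explicit convexity bound for `ζ`** (Trudgian 2011, Lemma 2.7, exact form): under the
all-`t` critical-line bound `|ζ(½+it)| ≤ K|Q+½+it|^θ` (`K > 0`, `θ ≥ 0`, `Q ≥ 0`) and for `c > 1`,
`½ ≤ σ ≤ c`, `s ≠ 1`:
`|ζ(s)| ≤ K^{(c−σ)/(c−½)} ζ(c)^{(σ−½)/(c−½)} |Q+s|^{θ(c−σ)/(c−½)} · |Q+s|/|s−1|`.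
Trudgian's printed Lemma 2.7 is the case `Q = 0` followed by the numerical simplifications
`|s|/|s−1| ≤ 1+δ`, `|s| ≤ (1+δ)t` for `t` large. [cite: Trudgian2011, Lemma 2.7]
[cite: Rademacher1959, Thm 2] -/
theorem norm_riemannZeta_le_convexity {K θ Q c : ℝ} (hK : 0 < K) (hθ : 0 ≤ θ) (hQ : 0 ≤ Q)
    (hc : 1 < c)
    (hline : ∀ t : ℝ, ‖riemannZeta (1 / 2 + t * I)‖ ≤ K * ‖(Q : ℂ) + (1 / 2 + t * I)‖ ^ θ)
    {s : ℂ} (h1 : 1 / 2 ≤ s.re) (h2 : s.re ≤ c) (hs : s ≠ 1) :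
    ‖riemannZeta s‖ ≤ K ^ ((c - s.re) / (c - 1 / 2)) *
      (riemannZeta (c : ℂ)).re ^ ((s.re - 1 / 2) / (c - 1 / 2)) *
      ‖(Q : ℂ) + s‖ ^ (θ * ((c - s.re) / (c - 1 / 2))) * (‖(Q : ℂ) + s‖ / ‖s - 1‖) := by
  have h := norm_riemannZeta₁_le_convexity hK hθ hQ hc hline h1 h2
  have hQs : 0 < ‖(Q : ℂ) + s‖ := by
    refine lt_of_lt_of_le (by linarith : 0 < Q + s.re) (le_trans ?_ (abs_re_le_norm _))
    simp only [add_re, ofReal_re]; rw [abs_of_pos (by linarith)]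
  have hs1 : 0 < ‖s - 1‖ := norm_pos_iff.2 (sub_ne_zero.2 hs)
  rw [LFunctions.riemannZeta₁_eq_mul hs, norm_mul] at h
  rw [Real.rpow_add hQs, Real.rpow_one] at h
  calc ‖riemannZeta s‖ = ‖s - 1‖ * ‖riemannZeta s‖ / ‖s - 1‖ := by field_simp
    _ ≤ K ^ ((c - s.re) / (c - 1 / 2)) * (riemannZeta (c : ℂ)).re ^ ((s.re - 1 / 2) / (c - 1 / 2)) *
        (‖(Q : ℂ) + s‖ ^ (θ * ((c - s.re) / (c - 1 / 2))) * ‖(Q : ℂ) + s‖) / ‖s - 1‖ := by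
        gcongr
    _ = _ := by ring

end Literature.NumberTheory.LFunctions

/-! ### Trudgian 2011, Lemma 2.8 (exact form): the upper bound for `∫_{1/2}^∞ log |ζ(σ+it)| dσ` -/

open Complex Real Set MeasureTheory intervalIntegral

namespace Literature.NumberTheory.LFunctions

/-- For real `σ > 1`, `‖ζ(σ)‖ = Re ζ(σ)` (Mathlib: `ζ(σ) > 0` in `ComplexOrder`). [folklore] -/
theorem norm_riemannZeta_ofReal_eq_re {σ : ℝ} (hσ : 1 < σ) :
    ‖riemannZeta σ‖ = (riemannZeta σ).re := by
  have him := riemannZeta_im_eq_zero_of_one_lt hσ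
  have hre := riemannZeta_re_pos_of_one_lt hσ
  rw [← Complex.re_add_im (riemannZeta σ), him]
  simp [abs_of_pos hre]

/-- `1 ≤ Re ζ(σ)` for real `σ > 1` (the first term of the Dirichlet series). [folklore] -/
theorem one_le_re_riemannZeta_ofReal {σ : ℝ} (hσ : 1 < σ) : 1 ≤ (riemannZeta σ).re := by
  have hσ' : 1 < (σ : ℂ).re := by simpa using hσ
  have hsum : Summable fun n : ℕ ↦ 1 / ((n : ℂ) + 1) ^ (σ : ℂ) := by
    have := (Complex.summable_one_div_nat_cpow (p := (σ : ℂ))).2 hσ'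
    rw [← summable_nat_add_iff 1] at this
    simpa using this
  have hterm : ∀ n : ℕ, (1 / ((n : ℂ) + 1) ^ (σ : ℂ)) = ((((n : ℝ) + 1) ^ σ)⁻¹ : ℝ) := by
    intro n
    have : ((n : ℂ) + 1) = (((n : ℝ) + 1 : ℝ) : ℂ) := by push_cast; ring
    rw [this, ← Complex.ofReal_cpow (by positivity), one_div, Complex.ofReal_inv]
  rw [zeta_eq_tsum_one_div_nat_add_one_cpow hσ', Complex.re_tsum hsum]
  simp_rw [hterm, Complex.ofReal_re]
  have hsum' : Summable fun n : ℕ ↦ (((n : ℝ) + 1) ^ σ)⁻¹ := by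
    have := Complex.reCLM.summable hsum
    refine this.congr fun n ↦ ?_
    simp only [Complex.reCLM_apply, hterm, Complex.ofReal_re]
  calc (1 : ℝ) = ((((0 : ℕ) : ℝ) + 1) ^ σ)⁻¹ := by simp
    _ ≤ ∑' n : ℕ, (((n : ℝ) + 1) ^ σ)⁻¹ := hsum'.le_tsum 0 (fun j _ ↦ by positivity)

/-- **`σ ↦ log ζ(σ)` is integrable on `(c, ∞)` for `c > 1`** (continuous, and
`|log ζ(σ)| ≤ (3/2)(ζ(σ) − 1) ≤ 4e^{−σ log 2}` beyond `σ = 3`, as in the tree's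
`integrableOn_log_norm_riemannZeta` for horizontal lines `t > 0`). [folklore] -/
theorem integrableOn_log_norm_riemannZeta_ofReal {c : ℝ} (hc : 1 < c) :
    IntegrableOn (fun σ : ℝ ↦ Real.log ‖riemannZeta σ‖) (Ioi c) := by
  have hne1 : ∀ x : ℝ, 1 < x → (x : ℂ) ≠ 1 := fun x hx h ↦ by
    have := congrArg Complex.re h; simp at this; linarith
  have hζ : ∀ x : ℝ, 1 < x → riemannZeta x ≠ 0 := fun x hx ↦
    riemannZeta_ne_zero_of_one_lt_re (by simpa using hx)
  have hcontAt : ∀ x : ℝ, 1 < x → ContinuousAt (fun x : ℝ ↦ Real.log ‖riemannZeta x‖) x := by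
    intro x hx
    have h1 : ContinuousAt (fun x : ℝ ↦ riemannZeta x) x :=
      (differentiableAt_riemannZeta (hne1 x hx)).continuousAt.comp (f := fun x : ℝ ↦ (x : ℂ))
        Complex.continuous_ofReal.continuousAt
    exact (h1.norm).log (norm_ne_zero_iff.2 (hζ x hx))
  set m : ℝ := max c 3 with hm
  -- near part: continuity on `[c, m]`
  have hnear : IntegrableOn (fun x : ℝ ↦ Real.log ‖riemannZeta x‖) (Ioc c m) := by
    have hcont : ContinuousOn (fun x : ℝ ↦ Real.log ‖riemannZeta x‖) (Icc c m) :=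
      fun x hx ↦ (hcontAt x (by linarith [hx.1])).continuousWithinAt
    exact (hcont.integrableOn_compact isCompact_Icc).mono_set Ioc_subset_Icc_self
  -- far part: domination by `4 e^{−(log 2) x}` on `(m, ∞) ⊆ (3, ∞)`
  have hfar : IntegrableOn (fun x : ℝ ↦ Real.log ‖riemannZeta x‖) (Ioi m) := by
    have hdom : IntegrableOn (fun x : ℝ ↦ 4 * Real.exp (-Real.log 2 * x)) (Ioi m) :=
      (exp_neg_integrableOn_Ioi m (Real.log_pos (by norm_num))).const_mul 4
    have hcont3 : ContinuousOn (fun x : ℝ ↦ Real.log ‖riemannZeta x‖) (Ioi m) :=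
      fun x hx ↦ (hcontAt x (by
        have : m < x := hx
        have : (3 : ℝ) ≤ m := le_max_right _ _
        linarith)).continuousWithinAt
    refine hdom.mono' (hcont3.aestronglyMeasurable measurableSet_Ioi) ?_
    rw [ae_restrict_iff' measurableSet_Ioi]
    refine Filter.Eventually.of_forall fun x hx ↦ ?_
    have hx3 : (3 : ℝ) < x := lt_of_le_of_lt (le_max_right _ _) hx
    have hb := norm_riemannZeta_sub_one_le_of_two_le_re (s := (x : ℂ)) (by simp; linarith)
    simp only [ofReal_re] at hb
    have hpow : (2 : ℝ) ^ (2 - x) = 4 * Real.exp (-Real.log 2 * x) := by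
      rw [Real.rpow_def_of_pos (by norm_num)]
      have : Real.log 2 * (2 - x) = 2 * Real.log 2 + -Real.log 2 * x := by ring
      rw [this, Real.exp_add, show (2 : ℝ) * Real.log 2 = Real.log 4 by
        rw [show (4 : ℝ) = 2 ^ 2 by norm_num, Real.log_pow]; norm_num, Real.exp_log (by norm_num)]
    have hpow_le : (2 : ℝ) ^ (2 - x) ≤ 1 / 2 := by
      have : (2 : ℝ) ^ (2 - x) ≤ (2 : ℝ) ^ (-1 : ℝ) :=
        Real.rpow_le_rpow_of_exponent_le (by norm_num) (by linarith)
      rw [Real.rpow_neg_one] at this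
      linarith
    have hπ : π ^ 2 / 6 - 1 ≤ 0.65 := by
      have := Real.pi_lt_d4; nlinarith [Real.pi_pos]
    have hπ0 : 0 ≤ π ^ 2 / 6 - 1 := by
      have := Real.pi_gt_three; nlinarith
    have hsmall : ‖riemannZeta x - 1‖ ≤ 1 / 2 := by
      refine hb.trans ?_
      calc (2 : ℝ) ^ (2 - x) * (π ^ 2 / 6 - 1) ≤ (1 / 2) * 0.65 := by gcongr
        _ ≤ 1 / 2 := by norm_num
    have hlog := abs_log_norm_le_of_norm_sub_one_le hsmall
    rw [Real.norm_eq_abs]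
    refine hlog.trans ?_
    calc 3 / 2 * ‖riemannZeta x - 1‖ ≤ 3 / 2 * ((2 : ℝ) ^ (2 - x) * (π ^ 2 / 6 - 1)) := by
          gcongr
      _ ≤ 3 / 2 * ((2 : ℝ) ^ (2 - x) * 0.65) := by gcongr
      _ = 3 / 2 * (4 * Real.exp (-Real.log 2 * x) * 0.65) := by rw [hpow]
      _ ≤ 4 * Real.exp (-Real.log 2 * x) := by nlinarith [Real.exp_pos (-Real.log 2 * x)]
  rw [← Ioc_union_Ioi_eq_Ioi (le_max_left c 3 : c ≤ m)]
  exact hnear.union hfar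

/-- **Trudgian's `m(c)` bound**: for `c > 1` and `t > 0` not an ordinate of a zero,
`∫_c^∞ log |ζ(σ+it)| dσ ≤ ∫_c^∞ log ζ(σ) dσ` (since `|ζ(σ+it)| ≤ ζ(σ)` termwise).
[cite: Trudgian2011, §2.2, display before Lemma 2.8] -/
theorem setIntegral_Ioi_log_norm_riemannZeta_le {c t : ℝ} (hc : 1 < c) (ht : 0 < t)
    (hord : ∀ ρ : ℂ, riemannZeta ρ = 0 → ρ.im ≠ t) :
    ∫ σ in Ioi c, Real.log ‖riemannZeta (σ + t * I)‖ ≤ ∫ σ in Ioi c, Real.log ‖riemannZeta σ‖ := by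
  refine setIntegral_mono_on
    ((integrableOn_log_norm_riemannZeta ht hord).mono_set (Ioi_subset_Ioi (by linarith)))
    (integrableOn_log_norm_riemannZeta_ofReal hc) measurableSet_Ioi fun σ hσ ↦ ?_
  have hσ1 : 1 < σ := lt_trans hc hσ
  have hre : 1 < ((σ : ℂ) + t * I).re := by simp; linarith
  have h0 : 0 < ‖riemannZeta (σ + t * I)‖ :=
    norm_pos_iff.2 (riemannZeta_ne_zero_of_one_lt_re hre)
  refine Real.log_le_log h0 ?_
  have := norm_riemannZeta_le_re_riemannZeta hre
  simp only [add_re, ofReal_re, mul_re, I_re, I_im, ofReal_im, mul_zero, mul_one, sub_self,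
    add_zero] at this
  rwa [norm_riemannZeta_ofReal_eq_re hσ1]

/-- **Trudgian 2011, Lemma 2.8 — the strip part, exact form.**  Under the all-`t` critical-line
bound `|ζ(½+iu)| ≤ K|Q+½+iu|^θ` (`K > 0`, `θ ≥ 0`, `Q ≥ 0`), for `c > 1` and `t > 0` not an
ordinate of a zero, with `M = |Q + c + it|`:
`∫_{1/2}^{c} log|ζ(σ+it)| dσ ≤ ½(c−½) log(K ζ(c)) + (θ(c−½)/2) log M + (c−½) log(M/t)`.
(Integrate the logarithm of `norm_riemannZeta_le_convexity`: `∫ p = ∫ (1−p) = (c−½)/2` for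
`p(σ) = (c−σ)/(c−½)`, `|Q+s| ≤ M`, `|s−1| ≥ t`.)  Trudgian's `a₁ + b₁ log t` form follows from
`log M ≤ log t + O(1/t²)`, `log(M/t) ≤ δ` for `t` large. [cite: Trudgian2011, Lemma 2.8] -/
theorem intervalIntegral_log_norm_riemannZeta_le {K θ Q c t : ℝ} (hK : 0 < K) (hθ : 0 ≤ θ)
    (hQ : 0 ≤ Q) (hc : 1 < c)
    (hline : ∀ u : ℝ, ‖riemannZeta (1 / 2 + u * I)‖ ≤ K * ‖(Q : ℂ) + (1 / 2 + u * I)‖ ^ θ)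
    (ht : 0 < t) (hord : ∀ ρ : ℂ, riemannZeta ρ = 0 → ρ.im ≠ t) :
    ∫ σ in (1 / 2 : ℝ)..c, Real.log ‖riemannZeta (σ + t * I)‖ ≤
      (c - 1 / 2) / 2 * Real.log (K * (riemannZeta c).re) +
        θ * ((c - 1 / 2) / 2) * Real.log ‖((Q + c : ℝ) : ℂ) + t * I‖ +
        (c - 1 / 2) * Real.log (‖((Q + c : ℝ) : ℂ) + t * I‖ / t) := by
  set M : ℝ := ‖((Q + c : ℝ) : ℂ) + t * I‖ with hM
  have hζc : 0 < (riemannZeta c).re := riemannZeta_re_pos_of_one_lt hc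
  have hMt : t ≤ M := by
    have := abs_im_le_norm (((Q + c : ℝ) : ℂ) + t * I)
    simp only [add_im, ofReal_im, mul_im, I_re, I_im, ofReal_re, mul_zero, mul_one, zero_add,
      add_zero] at this
    rw [abs_of_pos ht] at this
    simpa [hM] using this
  have hM0 : 0 < M := ht.trans_le hMt
  have hcm : 0 < c - 1 / 2 := by linarith
  -- the affine majorant
  set p : ℝ → ℝ := fun σ ↦ (c - σ) / (c - 1 / 2) with hp
  set q : ℝ → ℝ := fun σ ↦ (σ - 1 / 2) / (c - 1 / 2) with hq
  set B : ℝ → ℝ := fun σ ↦ p σ * Real.log K + q σ * Real.log (riemannZeta c).re +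
    θ * p σ * Real.log M + (Real.log M - Real.log t) with hB
  have hpt : ∀ σ ∈ Icc (1 / 2 : ℝ) c, Real.log ‖riemannZeta (σ + t * I)‖ ≤ B σ := by
    intro σ hσ
    set s : ℂ := (σ : ℂ) + t * I with hs
    have hsre : s.re = σ := by simp [hs]
    have hsim : s.im = t := by simp [hs]
    have hs1 : s ≠ 1 := fun h ↦ by have := congrArg Complex.im h; simp [hsim] at this; linarith
    have hζ0 : 0 < ‖riemannZeta s‖ :=
      norm_pos_iff.2 fun h ↦ hord s h hsim
    have hconv := norm_riemannZeta_le_convexity hK hθ hQ hc hline (s := s) (by rw [hsre]; exact hσ.1)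
      (by rw [hsre]; exact hσ.2) hs1
    rw [hsre] at hconv
    have hQs0 : 0 < ‖(Q : ℂ) + s‖ := by
      refine lt_of_lt_of_le (by linarith [hσ.1] : 0 < Q + σ) (le_trans ?_ (abs_re_le_norm _))
      simp [hs]; rw [abs_of_pos (by linarith [hσ.1])]
    have hQsM : ‖(Q : ℂ) + s‖ ≤ M := by
      have e1 : (Q : ℂ) + s = ((Q + σ : ℝ) : ℂ) + t * I := by simp [hs]; ring
      rw [e1, hM, Complex.norm_add_mul_I, Complex.norm_add_mul_I]
      exact Real.sqrt_le_sqrt (by nlinarith [hσ.1, hσ.2])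
    have hs1t : t ≤ ‖s - 1‖ := by
      have := abs_im_le_norm (s - 1)
      simp only [sub_im, one_im, sub_zero, hsim, abs_of_pos ht] at this
      exact this
    have hp0 : 0 ≤ p σ := div_nonneg (by linarith [hσ.2]) hcm.le
    -- logarithm of the convexity bound
    set r : ℝ := ‖(Q : ℂ) + s‖ with hr
    set d : ℝ := ‖s - 1‖ with hd
    have hd0 : 0 < d := ht.trans_le hs1t
    have hR0 : 0 < K ^ p σ * (riemannZeta c).re ^ q σ * r ^ (θ * p σ) * (r / d) := by positivity
    calc Real.log ‖riemannZeta s‖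
        ≤ Real.log (K ^ p σ * (riemannZeta c).re ^ q σ * r ^ (θ * p σ) * (r / d)) :=
          Real.log_le_log hζ0 hconv
      _ = p σ * Real.log K + q σ * Real.log (riemannZeta c).re +
            θ * p σ * Real.log r + (Real.log r - Real.log d) := by
          have h1 : K ^ p σ ≠ 0 := by positivity
          have h2 : (riemannZeta c).re ^ q σ ≠ 0 := by positivity
          have h3 : r ^ (θ * p σ) ≠ 0 := by positivity
          have h4 : r / d ≠ 0 := by positivity
          rw [Real.log_mul (by positivity) h4, Real.log_mul (by positivity) h3,
            Real.log_mul h1 h2, Real.log_rpow hK, Real.log_rpow hζc,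
            Real.log_rpow hQs0, Real.log_div hQs0.ne' hd0.ne']
      _ ≤ B σ := by
          simp only [hB]
          have l1 : Real.log r ≤ Real.log M := Real.log_le_log hQs0 hQsM
          have l2 : Real.log t ≤ Real.log d := Real.log_le_log ht hs1t
          have l3 : θ * p σ * Real.log r ≤ θ * p σ * Real.log M :=
            mul_le_mul_of_nonneg_left l1 (mul_nonneg hθ hp0)
          linarith
  -- integrate
  have hint : IntervalIntegrable (fun σ ↦ Real.log ‖riemannZeta (σ + t * I)‖) volume (1 / 2) c := by
    refine (intervalIntegrable_iff_integrableOn_Ioc_of_le (by linarith)).2 ?_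
    exact (integrableOn_log_norm_riemannZeta ht hord).mono_set Ioc_subset_Ioi_self
  have hBint : IntervalIntegrable B volume (1 / 2) c := by
    apply Continuous.intervalIntegrable; simp only [hB, hp, hq]; fun_prop
  have hmono := intervalIntegral.integral_mono_on (by linarith) hint hBint hpt
  refine hmono.trans (le_of_eq ?_)
  -- evaluate `∫ B`
  have hne : (c - 1 / 2 : ℝ) ≠ 0 := hcm.ne'
  set A₀ : ℝ := Real.log K * (c / (c - 1 / 2)) - Real.log (riemannZeta c).re * ((1 / 2) / (c - 1 / 2))
      + θ * Real.log M * (c / (c - 1 / 2)) + (Real.log M - Real.log t) with hA₀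
  set A₁ : ℝ := (Real.log (riemannZeta c).re - Real.log K - θ * Real.log M) / (c - 1 / 2) with hA₁
  have e : ∫ σ in (1 / 2 : ℝ)..c, B σ = ∫ σ in (1 / 2 : ℝ)..c, (A₀ + σ * A₁) := by
    refine intervalIntegral.integral_congr fun σ _ ↦ ?_
    simp only [hB, hp, hq, hA₀, hA₁]; field_simp; ring
  have hii : IntervalIntegrable (fun σ : ℝ ↦ σ * A₁) volume (1 / 2) c :=
    (continuous_id.mul continuous_const).intervalIntegrable _ _
  rw [e, intervalIntegral.integral_add (f := fun _ ↦ A₀) (g := fun σ : ℝ ↦ σ * A₁)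
      intervalIntegrable_const hii,
    intervalIntegral.integral_const, intervalIntegral.integral_mul_const, integral_id,
    Real.log_mul hK.ne' hζc.ne', Real.log_div hM0.ne' ht.ne']
  simp only [smul_eq_mul, hA₀, hA₁]
  have hne2 : (-1 + c * 2 : ℝ) ≠ 0 := by linarith
  have hne3 : (c * 2 - 1 : ℝ) ≠ 0 := by linarith
  field_simp
  ring

/-- **Trudgian 2011, Lemma 2.8 (exact form).**  With the notation and hypotheses of
`intervalIntegral_log_norm_riemannZeta_le`,
`∫_{1/2}^∞ log|ζ(σ+it)| dσ ≤ ∫_c^∞ log ζ(σ) dσ + ½(c−½) log(Kζ(c)) + (θ(c−½)/2) log M + (c−½) log(M/t)`,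
`M = |Q+c+it|` — Trudgian's `a₁ + b₁ log t` with `a₁ = ∫_c^∞ log ζ + ½(c−½) log(Kζ(c)) + δ`,
`b₁ = θ(c−½)/2`, before the final roundings `log M ≤ log t + …`. [cite: Trudgian2011, Lemma 2.8] -/
theorem setIntegral_Ioi_half_log_norm_riemannZeta_le {K θ Q c t : ℝ} (hK : 0 < K) (hθ : 0 ≤ θ)
    (hQ : 0 ≤ Q) (hc : 1 < c)
    (hline : ∀ u : ℝ, ‖riemannZeta (1 / 2 + u * I)‖ ≤ K * ‖(Q : ℂ) + (1 / 2 + u * I)‖ ^ θ)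
    (ht : 0 < t) (hord : ∀ ρ : ℂ, riemannZeta ρ = 0 → ρ.im ≠ t) :
    ∫ σ in Ioi (1 / 2 : ℝ), Real.log ‖riemannZeta (σ + t * I)‖ ≤
      (∫ σ in Ioi c, Real.log ‖riemannZeta σ‖) +
        (c - 1 / 2) / 2 * Real.log (K * (riemannZeta c).re) +
        θ * ((c - 1 / 2) / 2) * Real.log ‖((Q + c : ℝ) : ℂ) + t * I‖ +
        (c - 1 / 2) * Real.log (‖((Q + c : ℝ) : ℂ) + t * I‖ / t) := by
  have hI := integrableOn_log_norm_riemannZeta ht hord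
  have hsplit : ∫ σ in Ioi (1 / 2 : ℝ), Real.log ‖riemannZeta (σ + t * I)‖ =
      (∫ σ in (1 / 2 : ℝ)..c, Real.log ‖riemannZeta (σ + t * I)‖) +
        ∫ σ in Ioi c, Real.log ‖riemannZeta (σ + t * I)‖ := by
    rw [← Ioc_union_Ioi_eq_Ioi (show (1 / 2 : ℝ) ≤ c by linarith),
      setIntegral_union (Ioc_disjoint_Ioi le_rfl) measurableSet_Ioi
        (hI.mono_set Ioc_subset_Ioi_self) (hI.mono_set (Ioi_subset_Ioi (by linarith))),
      intervalIntegral.integral_of_le (by linarith)]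
  rw [hsplit]
  have h1 := intervalIntegral_log_norm_riemannZeta_le hK hθ hQ hc hline ht hord
  have h2 := setIntegral_Ioi_log_norm_riemannZeta_le hc ht hord
  linarith

end Literature.NumberTheory.LFunctions

open Complex Real Set MeasureTheory intervalIntegral

namespace Literature.NumberTheory.LFunctions

/-- `log √(A² + t²) ≤ log t + A²/(2t²)` for `t > 0` (`log(1+x) ≤ x`). [folklore] -/
theorem log_norm_add_mul_I_le (A : ℝ) {t : ℝ} (ht : 0 < t) :
    Real.log ‖((A : ℝ) : ℂ) + t * I‖ ≤ Real.log t + A ^ 2 / (2 * t ^ 2) := by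
  rw [Complex.norm_add_mul_I, Real.log_sqrt (by positivity)]
  have h1 : Real.log (A ^ 2 + t ^ 2) = 2 * Real.log t + Real.log (1 + A ^ 2 / t ^ 2) := by
    have : A ^ 2 + t ^ 2 = t ^ 2 * (1 + A ^ 2 / t ^ 2) := by field_simp; ring
    rw [this, Real.log_mul (by positivity) (by positivity), Real.log_pow]; push_cast; ring
  have h2 : Real.log (1 + A ^ 2 / t ^ 2) ≤ A ^ 2 / t ^ 2 := by
    have := Real.log_le_sub_one_of_pos (by positivity : 0 < 1 + A ^ 2 / t ^ 2); linarith
  rw [h1]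
  have : (2 * Real.log t + Real.log (1 + A ^ 2 / t ^ 2)) / 2 ≤ Real.log t + A ^ 2 / t ^ 2 / 2 := by
    linarith
  calc (2 * Real.log t + Real.log (1 + A ^ 2 / t ^ 2)) / 2 ≤ Real.log t + A ^ 2 / t ^ 2 / 2 := this
    _ = Real.log t + A ^ 2 / (2 * t ^ 2) := by ring

/-- **Trudgian 2011, Lemma 2.8, in the form `a₁ + b₁ log t`** (his `δ` made explicit): under the
hypotheses of `setIntegral_Ioi_half_log_norm_riemannZeta_le`, for `t > t₀ ≥ 1` not an ordinate,
`∫_{1/2}^∞ log|ζ(σ+it)| dσ ≤ a₁ + b₁ log t` with `b₁ = θ(c−½)/2` and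
`a₁ = ∫_c^∞ log ζ + ½(c−½) log(Kζ(c)) + (b₁ + (c−½)) (Q+c)²/(2t₀²)`
(from `log M ≤ log t + (Q+c)²/(2t²)`, `log(M/t) ≤ (Q+c)²/(2t²)`, `M = |Q+c+it|`).
[cite: Trudgian2011, Lemma 2.8] -/
theorem setIntegral_Ioi_half_log_norm_riemannZeta_le' {K θ Q c t₀ t : ℝ} (hK : 0 < K)
    (hθ : 0 ≤ θ) (hQ : 0 ≤ Q) (hc : 1 < c) (ht₀ : 1 ≤ t₀)
    (hline : ∀ u : ℝ, ‖riemannZeta (1 / 2 + u * I)‖ ≤ K * ‖(Q : ℂ) + (1 / 2 + u * I)‖ ^ θ)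
    (ht : t₀ < t) (hord : ∀ ρ : ℂ, riemannZeta ρ = 0 → ρ.im ≠ t) :
    ∫ σ in Ioi (1 / 2 : ℝ), Real.log ‖riemannZeta (σ + t * I)‖ ≤
      ((∫ σ in Ioi c, Real.log ‖riemannZeta σ‖) + (c - 1 / 2) / 2 * Real.log (K * (riemannZeta c).re)
        + (θ * ((c - 1 / 2) / 2) + (c - 1 / 2)) * ((Q + c) ^ 2 / (2 * t₀ ^ 2)))
      + θ * ((c - 1 / 2) / 2) * Real.log t := by
  have ht0 : 0 < t := by linarith
  have h := setIntegral_Ioi_half_log_norm_riemannZeta_le hK hθ hQ hc hline ht0 hord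
  set M : ℝ := ‖((Q + c : ℝ) : ℂ) + t * I‖ with hM
  have hMt : t ≤ M := by
    have := abs_im_le_norm (((Q + c : ℝ) : ℂ) + t * I)
    simp only [add_im, ofReal_im, mul_im, I_re, I_im, ofReal_re, mul_zero, mul_one, zero_add,
      add_zero] at this
    rw [abs_of_pos ht0] at this
    simpa [hM] using this
  have hM0 : 0 < M := ht0.trans_le hMt
  have hlogM : Real.log M ≤ Real.log t + (Q + c) ^ 2 / (2 * t ^ 2) :=
    log_norm_add_mul_I_le _ ht0
  have hlogMt : Real.log (M / t) ≤ (Q + c) ^ 2 / (2 * t ^ 2) := by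
    rw [Real.log_div hM0.ne' ht0.ne']; linarith
  have hfrac : (Q + c) ^ 2 / (2 * t ^ 2) ≤ (Q + c) ^ 2 / (2 * t₀ ^ 2) := by
    gcongr
  have hcm : 0 ≤ c - 1 / 2 := by linarith
  have hb : 0 ≤ θ * ((c - 1 / 2) / 2) := by positivity
  have e1 : θ * ((c - 1 / 2) / 2) * Real.log M ≤
      θ * ((c - 1 / 2) / 2) * (Real.log t + (Q + c) ^ 2 / (2 * t₀ ^ 2)) :=
    mul_le_mul_of_nonneg_left (hlogM.trans (by linarith)) hb
  have e2 : (c - 1 / 2) * Real.log (M / t) ≤ (c - 1 / 2) * ((Q + c) ^ 2 / (2 * t₀ ^ 2)) :=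
    mul_le_mul_of_nonneg_left (hlogMt.trans hfrac) hcm
  linarith

end Literature.NumberTheory.LFunctions

/-! ### Assembly: `|∫ S| ≤ a + b log t₂` from upper/lower bounds for `∫ log|ζ|` (Thm 2.12 glue) -/

open Complex Set MeasureTheory Filter Topology intervalIntegral
open scoped Real

namespace Literature.NumberTheory.LFunctions

/-- **Turing's method, assembly of the `∫ S` bound from bounds for `∫ log|ζ|`**
([Trudgian 2011, "Lemmas 2.4, 2.8 and 2.11 prove at once Theorem 2.12"]; Lehman 1970, §4):
if for every `t > t₀` that is not an ordinate of a zero,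
`U(t) := ∫_{1/2}^∞ log|ζ(σ+it)| dσ ≤ a₁ + b₁ log t` and `−U(t) ≤ a₂ + b₂ log t` (`b₁, b₂ ≥ 0`),
then for all non-ordinates `t₀ < t₁ ≤ t₂`,
`|∫_{t₁}^{t₂} S(t) dt| ≤ (a₁ + a₂)/π + ((b₁ + b₂)/π) log t₂`
(Turing's lemma `π ∫_{t₁}^{t₂} S = U(t₂) − U(t₁)`, `Literature.NumberTheory.LFunctions.pi_mul_integral_zetaArgS_eq`).
[cite: Trudgian2011, Thm 2.12 (proof)] -/
theorem abs_integral_zetaArgS_le_of_bounds_of_not_ordinate {a₁ b₁ a₂ b₂ t₀ : ℝ} (ht₀ : 1 ≤ t₀)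
    (hb₁ : 0 ≤ b₁) (hb₂ : 0 ≤ b₂)
    (hU : ∀ t : ℝ, t₀ < t → (∀ ρ : ℂ, riemannZeta ρ = 0 → ρ.im ≠ t) →
      ∫ x in Ioi (1 / 2 : ℝ), Real.log ‖riemannZeta (x + t * I)‖ ≤ a₁ + b₁ * Real.log t)
    (hL : ∀ t : ℝ, t₀ < t → (∀ ρ : ℂ, riemannZeta ρ = 0 → ρ.im ≠ t) →
      -(∫ x in Ioi (1 / 2 : ℝ), Real.log ‖riemannZeta (x + t * I)‖) ≤ a₂ + b₂ * Real.log t)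
    {t₁ t₂ : ℝ} (h₁ : t₀ < t₁) (h12 : t₁ ≤ t₂)
    (h1' : ∀ ρ : ℂ, riemannZeta ρ = 0 → ρ.im ≠ t₁) (h2' : ∀ ρ : ℂ, riemannZeta ρ = 0 → ρ.im ≠ t₂) :
    |∫ t in t₁..t₂, zetaArgS t| ≤ (a₁ + a₂) / π + (b₁ + b₂) / π * Real.log t₂ := by
  have hπ := Real.pi_pos
  have ht₁ : 0 < t₁ := by linarith
  have hT := pi_mul_integral_zetaArgS_eq ht₁ h12 h1' h2'
  set U₁ := ∫ x in Ioi (1 / 2 : ℝ), Real.log ‖riemannZeta (x + t₁ * I)‖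
  set U₂ := ∫ x in Ioi (1 / 2 : ℝ), Real.log ‖riemannZeta (x + t₂ * I)‖
  have hU1 := hU t₁ h₁ h1'
  have hU2 := hU t₂ (h₁.trans_le h12) h2'
  have hL1 := hL t₁ h₁ h1'
  have hL2 := hL t₂ (h₁.trans_le h12) h2'
  have hlog : Real.log t₁ ≤ Real.log t₂ := Real.log_le_log ht₁ h12
  have hlog0 : 0 ≤ Real.log t₁ := Real.log_nonneg (by linarith)
  have key : π * |∫ t in t₁..t₂, zetaArgS t| ≤ (a₁ + a₂) + (b₁ + b₂) * Real.log t₂ := by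
    rw [← abs_of_pos hπ, ← abs_mul, hT, abs_le]
    constructor <;> nlinarith
  rw [show (a₁ + a₂) / π + (b₁ + b₂) / π * Real.log t₂ = ((a₁ + a₂) + (b₁ + b₂) * Real.log t₂) / π by
    ring, le_div_iff₀ hπ]
  linarith

/-- The same for **all** `t₀ < t₁ ≤ t₂` (ordinates included), by the density of non-ordinates and
the continuity of `u ↦ ∫ S` (as in `Literature.NumberTheory.LFunctions.exists_abs_integral_zetaArgS_le`). This is the form of
[Trudgian 2011, Thm 2.12] / [Lehman 1970, Thm 4]: `|∫_{t₁}^{t₂} S(t) dt| ≤ a + b log t₂` with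
`a = (a₁+a₂)/π`, `b = (b₁+b₂)/π`. [cite: Trudgian2011, Thm 2.12] -/
theorem abs_integral_zetaArgS_le_of_bounds {a₁ b₁ a₂ b₂ t₀ : ℝ} (ht₀ : 1 ≤ t₀)
    (hb₁ : 0 ≤ b₁) (hb₂ : 0 ≤ b₂)
    (hU : ∀ t : ℝ, t₀ < t → (∀ ρ : ℂ, riemannZeta ρ = 0 → ρ.im ≠ t) →
      ∫ x in Ioi (1 / 2 : ℝ), Real.log ‖riemannZeta (x + t * I)‖ ≤ a₁ + b₁ * Real.log t)
    (hL : ∀ t : ℝ, t₀ < t → (∀ ρ : ℂ, riemannZeta ρ = 0 → ρ.im ≠ t) →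
      -(∫ x in Ioi (1 / 2 : ℝ), Real.log ‖riemannZeta (x + t * I)‖) ≤ a₂ + b₂ * Real.log t)
    {t₁ t₂ : ℝ} (h₁ : t₀ < t₁) (h12 : t₁ ≤ t₂) :
    |∫ t in t₁..t₂, zetaArgS t| ≤ (a₁ + a₂) / π + (b₁ + b₂) / π * Real.log t₂ := by
  set a : ℝ := (a₁ + a₂) / π
  set b : ℝ := (b₁ + b₂) / π
  have hb : 0 ≤ b := by positivity
  have hbase : ∀ u₁ u₂ : ℝ, t₀ < u₁ → u₁ ≤ u₂ → (∀ ρ : ℂ, riemannZeta ρ = 0 → ρ.im ≠ u₁) →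
      (∀ ρ : ℂ, riemannZeta ρ = 0 → ρ.im ≠ u₂) → |∫ t in u₁..u₂, zetaArgS t| ≤ a + b * Real.log u₂ :=
    fun u₁ u₂ hu₁ hu hn₁ hn₂ ↦
      abs_integral_zetaArgS_le_of_bounds_of_not_ordinate ht₀ hb₁ hb₂ hU hL hu₁ hu hn₁ hn₂
  -- the degenerate case needs `a + b log t₂ ≥ 0`, which follows from the bound at nearby points
  -- interval integrability of `S` and continuity of its primitives
  have hθc : Continuous riemannSiegelTheta :=
    continuous_iff_continuousAt.2 fun t ↦ (hasDerivAt_riemannSiegelTheta_holds t).continuousAt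
  have hS : ∀ a b : ℝ, IntervalIntegrable zetaArgS volume a b := by
    intro a b
    have hN : IntervalIntegrable (fun T : ℝ ↦ (zetaZeroCount T : ℝ)) volume a b :=
      Monotone.intervalIntegrable fun x y hxy ↦ Nat.cast_le.2 (zetaZeroCount_mono hxy)
    have h := (hN.sub ((hθc.div_const π).intervalIntegrable a b)).sub
      (intervalIntegrable_const (c := (1 : ℝ)))
    have e : zetaArgS = fun T ↦ (zetaZeroCount T : ℝ) - riemannSiegelTheta T / π - 1 := by
      funext T; rfl
    rw [e]; exact h
  have hprim : ∀ a : ℝ, Continuous fun b ↦ ∫ t in a..b, zetaArgS t := fun a ↦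
    intervalIntegral.continuous_primitive hS a
  -- non-ordinates are dense
  have hdense : ∀ a b : ℝ, a < b → 0 ≤ a →
      ∃ t ∈ Ioo a b, ∀ ρ : ℂ, riemannZeta ρ = 0 → ρ.im ≠ t := by
    intro a b hab ha
    set Ords : Set ℝ := Complex.im '' zetaZeroBox 0 b with hO
    have hfin : Ords.Finite := (zetaZeroBox_finite 0 b).image _
    obtain ⟨t, ht⟩ := ((Ioo_infinite hab).sdiff hfin).nonempty
    refine ⟨t, ht.1, fun ρ hρ him ↦ ht.2 ?_⟩
    have ht0 : 0 < t := ha.trans_lt ht.1.1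
    have hst := re_mem_Ioo_of_riemannZeta_eq_zero_of_im_ne_zero hρ (by rw [him]; exact ht0.ne')
    exact ⟨ρ, ⟨hρ, hst.1.le, hst.2.le, by rw [him]; exact ht0, by rw [him]; exact ht.1.2.le⟩, him⟩
  have ht₁0 : 0 ≤ t₁ := by linarith
  -- sequences `u₁ₙ ↓ t₁` (with `u₁ₙ ≤ u₂ₙ`) and `u₂ₙ ↓ t₂` of non-ordinates
  choose u₂ hu₂ hu₂' using fun n : ℕ ↦ hdense t₂ (t₂ + 1 / ((n : ℝ) + 1)) (by
    have : (0 : ℝ) < 1 / ((n : ℝ) + 1) := by positivity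
    linarith) (by linarith)
  have hpos : ∀ n : ℕ, t₁ < min (t₁ + 1 / ((n : ℝ) + 1)) (u₂ n) := fun n ↦
    lt_min (by have : (0 : ℝ) < 1 / ((n : ℝ) + 1) := by positivity
               linarith) (lt_of_le_of_lt h12 (hu₂ n).1)
  choose u₁ hu₁ hu₁' using fun n : ℕ ↦ hdense t₁ (min (t₁ + 1 / ((n : ℝ) + 1)) (u₂ n)) (hpos n) ht₁0
  have hlim1 : Tendsto u₁ atTop (𝓝 t₁) := by
    have h0 : Tendsto (fun n : ℕ ↦ t₁ + 1 / ((n : ℝ) + 1)) atTop (𝓝 (t₁ + 0)) :=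
      tendsto_const_nhds.add tendsto_one_div_add_atTop_nhds_zero_nat
    rw [add_zero] at h0
    refine tendsto_of_tendsto_of_tendsto_of_le_of_le tendsto_const_nhds h0 (fun n ↦ (hu₁ n).1.le)
      fun n ↦ (hu₁ n).2.le.trans (min_le_left _ _)
  have hlim2 : Tendsto u₂ atTop (𝓝 t₂) := by
    have h0 : Tendsto (fun n : ℕ ↦ t₂ + 1 / ((n : ℝ) + 1)) atTop (𝓝 (t₂ + 0)) :=
      tendsto_const_nhds.add tendsto_one_div_add_atTop_nhds_zero_nat
    rw [add_zero] at h0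
    exact tendsto_of_tendsto_of_tendsto_of_le_of_le tendsto_const_nhds h0 (fun n ↦ (hu₂ n).1.le)
      fun n ↦ (hu₂ n).2.le
  have hbound : ∀ n, |∫ t in u₁ n..u₂ n, zetaArgS t| ≤ a + b * Real.log (u₂ n) := fun n ↦
    hbase (u₁ n) (u₂ n) (h₁.trans (hu₁ n).1) ((hu₁ n).2.le.trans (min_le_right _ _)) (hu₁' n) (hu₂' n)
  have hLim : Tendsto (fun n ↦ |∫ t in u₁ n..u₂ n, zetaArgS t|) atTop
      (𝓝 |∫ t in t₁..t₂, zetaArgS t|) := by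
    have e : ∀ n, ∫ t in u₁ n..u₂ n, zetaArgS t =
        (∫ t in t₁..u₂ n, zetaArgS t) - ∫ t in t₁..u₁ n, zetaArgS t := fun n ↦ by
      rw [← intervalIntegral.integral_add_adjacent_intervals (hS t₁ (u₁ n)) (hS (u₁ n) (u₂ n))]
      ring
    simp_rw [e]
    have h1 := (hprim t₁).continuousAt.tendsto.comp hlim1
    have h2 := (hprim t₁).continuousAt.tendsto.comp hlim2
    simp only [Function.comp_def, intervalIntegral.integral_same] at h1 h2
    have := (h2.sub h1).abs
    simpa using this
  have ht₂ : 0 < t₂ := by linarith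
  have hR : Tendsto (fun n ↦ a + b * Real.log (u₂ n)) atTop (𝓝 (a + b * Real.log t₂)) := by
    have hc : ContinuousAt (fun x : ℝ ↦ a + b * Real.log x) t₂ :=
      continuousAt_const.add ((Real.continuousAt_log ht₂.ne').const_mul b)
    exact hc.tendsto.comp hlim2
  exact le_of_tendsto_of_tendsto' hLim hR hbound

end Literature.NumberTheory.LFunctions
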